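/-
Copyright: H21 programme, solo seat `solo-RiemannHypothesis-informed` (session 5).
-/
import Summits.RiemannHypothesis.RiemannHypothesis.Theorems.SoloInformedClusterFarWindow

/-!
# Far zeros under an arbitrary offset bound (solo-informed, T30–T31)

T28/T29 (`SoloInformedClusterFar`, `SoloInformedClusterFarWindow`) ask that the far zeros of the
polylog window have offset `≤ η`, the offset of the designated zero.  The same argument runs with
ANY bound `θ < ½` on the far offsets: the far terms then cost `e^{2θ(c+1)}/Δ₀²` (T28a with this
`θ`), which is `≤ 1` once the near zone has radius `Δ₀ ≥ e^{θ(c+1)}` — still strictly inside the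
window, since `R ≥ e^{(c+1)/2}` and `θ < ½`.  So the one-parameter family

* `weilGroundEnergy_neg_of_farOffset_cluster_eff` (**T30**, threshold form),
* `weilGroundEnergy_neg_of_farOffset_cluster_window_eff` (**T31**, window form with the SAME offset
  `clusterFarC0` as T29), the parameter-free form (**T31′**) and the exclusion form (**T31″**)

interpolates between T28 (`θ = η`: near zone `e^{η(c+1)} ≍ C (log γ₀)^{1/2}`) and a statement with
NO hypothesis on the far zeros (**T32**,
`riemannZeta_ne_zero_of_nearCluster_of_weilGroundEnergy_nonneg_eff`: `θ = windowMaxOffset γ₀ R`, the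
largest offset occurring in the window, `< ½` because the window holds finitely many zeros, all
with `0 < Re ρ < 1`): near zone `e^{θ(c+1)} ≍ C (log γ₀)^{θ/(2η)}`,
at most `R^{2θ} < R` (`exp_windowMaxOffset_mul_lt`), against the window `R ≍ C′ (log γ₀)^{1/(4η)}`.
The residual "non-maximal offset" of the T29 wall is thereby quantified: domination by offsets up
to `θ` costs only the growth of the near zone from `(log γ₀)^{1/2}` to `(log γ₀)^{θ/(2η)}`.
-/

open MeasureTheory Complex Set Filter Topology Literature.NumberTheory.LFunctions
open scoped ContDiff

namespace Summit.RiemannHypothesis.RiemannHypothesis.Theorems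

variable {ψ : ℝ → ℝ}

/-! ## T30: threshold form -/

/-- **T30 (far-offset cluster visibility, effective).**  As T28
(`weilGroundEnergy_neg_of_maxOffset_cluster_eff`) with the offsets of the far zeros bounded by an
arbitrary `θ < ½` instead of `η`: every off-line zero `ρ` of the window `|Im ρ − γ₀| < R` is `ρ₀`,
`ρ₁`, a member of the near cluster `S'`, OR satisfies `|Re ρ − ½| ≤ θ` and `|Im ρ − γ₀| ≥ Δ₀`;
the threshold becomes
`K_N(ψ,R₀)·(1 + e^{2θ(c+1)}/Δ₀²)·log(|γ₀|+2) < η⁴ δ^{4N} (e^{ηc}Φ(η) − Φ(−η))²`.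
(`θ = η`: T28; `θ = windowMaxOffset γ₀ R`: no hypothesis on the far zeros, T32.) -/
theorem weilGroundEnergy_neg_of_farOffset_cluster_eff (hψ : ContDiff ℝ ∞ ψ)
    (hsupp : tsupport ψ ⊆ Icc (-1) 1) (hψ0 : ∀ s, 0 ≤ ψ s) (N : ℕ) (R₀ : ℝ) :
    ∀ (η θ γ₀ c R δ Δ₀ : ℝ) (S' : Finset ℂ), 0 < η → η < 1 / 2 → θ < 1 / 2 → γ₀ ≠ 0 → 0 ≤ c →
      1 ≤ R → Real.exp (c + 1) ≤ R ^ 2 → 0 < δ → δ ≤ 1 → 1 ≤ Δ₀ →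
      riemannZeta (1 / 2 + η + γ₀ * I) = 0 → S'.card ≤ N →
      (∀ ρ ∈ S', ‖ρ - (1 / 2 + γ₀ * I)‖ ≤ R₀ ∧ δ ≤ ‖ρ - (1 / 2 + η + γ₀ * I)‖ ∧
          δ ≤ ‖ρ - (1 / 2 - η + γ₀ * I)‖) →
      (∀ ρ : ℂ, riemannZeta ρ = 0 → 0 ≤ ρ.re → ρ.re ≤ 1 → |ρ.im - γ₀| < R → ρ.re ≠ 1 / 2 →
          ρ = 1 / 2 + η + γ₀ * I ∨ ρ = 1 / 2 - η + γ₀ * I ∨ ρ ∈ S' ∨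
            (|ρ.re - 1 / 2| ≤ θ ∧ Δ₀ ≤ |ρ.im - γ₀|)) →
      bumpLaplace ψ (-η) ≤ Real.exp (η * c) * bumpLaplace ψ η →
      (clusterK ψ N R₀ * (1 + Real.exp (θ * (c + 1)) ^ 2 / Δ₀ ^ 2) * Real.log (|γ₀| + 2) <
          η ^ 4 * δ ^ (4 * N) *
            (Real.exp (η * c) * bumpLaplace ψ η - bumpLaplace ψ (-η)) ^ 2) →
      weilGroundEnergy (c + 1) < 0 := by
  intro η θ γ₀ c R δ Δ₀ S' hη hη2 hθ2 hγ hc hR hRa hδ hδ1 hΔ hζ hcard hclus hloc hgainpos hwin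
  unfold clusterK at hwin
  have hT := weilGroundEnergy_neg_of_local_oddTest_cluster_far
  set A₁ : ℝ := zetaDensityConst
  have hA₁ : 0 < A₁ := zetaDensityConst_pos
  set Q : ℝ := (1 + R₀ ^ 2) ^ N * bumpNormSum ψ (2 * N + 4) with hQ_def
  have hQ0 : 0 ≤ Q := by have := bumpNormSum_nonneg ψ (2 * N + 4); positivity
  set X : ℝ := Real.exp (θ * (c + 1)) ^ 2 / Δ₀ ^ 2 with hX_def
  have hΔ0 : 0 < Δ₀ := by linarith
  have hX0 : 0 ≤ X := by positivity
  set g : ℝ := Real.exp (η * c) * bumpLaplace ψ η - bumpLaplace ψ (-η) with hg_def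
  have hlog : 0 < Real.log (|γ₀| + 2) := Real.log_pos (by linarith [abs_nonneg γ₀])
  have hXL : 0 ≤ X * Real.log (|γ₀| + 2) := mul_nonneg hX0 hlog.le
  have hAXL : 0 ≤ A₁ * Q ^ 2 * X * Real.log (|γ₀| + 2) := by
    have := hA₁.le; positivity
  have hg0 : 0 ≤ g := sub_nonneg.mpr hgainpos
  have hgpos : 0 < g := by
    rcases hg0.lt_or_eq with h | h
    · exact h
    · exfalso
      rw [← h] at hwin
      have : 0 < (16 * A₁ * Q ^ 2 + 1) * (1 + X) * Real.log (|γ₀| + 2) := by positivity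
      norm_num at hwin
      linarith
  -- the cluster test and the far set
  obtain ⟨k, hk, hkodd, hks, hpos, hnorm, hG, hvan⟩ :=
    exists_clusterTest hψ hsupp hψ0 N R₀ (γ₀ := γ₀) (S' := S') hη hc hδ hδ1 hcard hclus hgpos
  obtain ⟨Sf, hSf_mem, hSf_all⟩ := exists_far_finset θ γ₀ R Δ₀ hθ2
  have hSf1 : ∀ ρ ∈ Sf, ρ ≠ 1 := by
    intro ρ hρ h1
    have hz := (hSf_mem ρ hρ).1
    rw [h1] at hz
    exact riemannZeta_one_ne_zero hz
  have hloc4 : ∀ ρ : ℂ, riemannZeta ρ = 0 → 0 ≤ ρ.re → ρ.re ≤ 1 → |ρ.im - γ₀| < R →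
      ρ.re ≠ 1 / 2 → ρ = 1 / 2 + η + γ₀ * I ∨ ρ = 1 / 2 - η + γ₀ * I ∨ ρ ∈ S' ∨ ρ ∈ Sf := by
    intro ρ hz h0 h1 hnear hre
    rcases hloc ρ hz h0 h1 hnear hre with h | h | h | ⟨hoff, hfarρ⟩
    · exact Or.inl h
    · exact Or.inr (Or.inl h)
    · exact Or.inr (Or.inr (Or.inl h))
    · exact Or.inr (Or.inr (Or.inr (hSf_all ρ hz hoff hfarρ hnear)))
  -- the on-line majorant (as in T25)
  have hk1 : ∫ t, ‖k t‖ ≤ 2 * Q := by simpa using hnorm 0 (by norm_num)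
  have hk2 : ∫ t, ‖deriv k t‖ ≤ 2 * Q := by simpa using hnorm 1 (by norm_num)
  have hk3 : ∫ t, ‖iteratedDeriv 2 k t‖ ≤ 2 * Q := hnorm 2 le_rfl
  have hMloc : ((∫ t, ‖k t‖) ^ 2 + (∫ t, ‖deriv k t‖) ^ 2)
      + 2 * Real.exp (c + 1) * (∫ t, ‖iteratedDeriv 2 k t‖) ^ 2 / R ^ (2 * 1)
        ≤ 4 * (Q ^ 2 + Q ^ 2 + 2 * Q ^ 2) :=
    local_majorant_arith (integral_nonneg fun _ ↦ norm_nonneg _)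
      (integral_nonneg fun _ ↦ norm_nonneg _) (integral_nonneg fun _ ↦ norm_nonneg _) hk1 hk2 hk3
      (Real.exp_pos _) (by simpa using hRa)
  have h1 : 2 * A₁ * (((∫ t, ‖k t‖) ^ 2 + (∫ t, ‖deriv k t‖) ^ 2)
      + 2 * Real.exp (c + 1) * (∫ t, ‖iteratedDeriv 2 k t‖) ^ 2 / R ^ (2 * 1))
        * Real.log (|γ₀| + 2)
      ≤ 2 * A₁ * (4 * (Q ^ 2 + Q ^ 2 + 2 * Q ^ 2)) * Real.log (|γ₀| + 2) :=
    mul_le_mul_of_nonneg_right (mul_le_mul_of_nonneg_left hMloc (by positivity)) hlog.le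
  -- the far terms (T28a with `p = 2`)
  have hF1 := sum_offline_far_le hk (by linarith : (0 : ℝ) ≤ c + 1) hks hθ2 hΔ
    (p := 2) (by norm_num) Sf hSf_mem
  have hBf : 2 * A₁ * (2 * (Real.exp (θ * (c + 1)) * ∫ t, ‖iteratedDeriv 2 k t‖) ^ 2
      / Δ₀ ^ (2 * 2 - 2)) * Real.log (|γ₀| + 2) ≤ 16 * (A₁ * Q ^ 2 * X * Real.log (|γ₀| + 2)) := by
    have h22 : Δ₀ ^ (2 * 2 - 2) = Δ₀ ^ 2 := by norm_num
    rw [h22]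
    have hEN : (Real.exp (θ * (c + 1)) * ∫ t, ‖iteratedDeriv 2 k t‖) ^ 2 ≤
        (Real.exp (θ * (c + 1)) * (2 * Q)) ^ 2 :=
      pow_le_pow_left₀ (by positivity) (mul_le_mul_of_nonneg_left hk3 (Real.exp_pos _).le) 2
    have h3 : 2 * (Real.exp (θ * (c + 1)) * ∫ t, ‖iteratedDeriv 2 k t‖) ^ 2 / Δ₀ ^ 2 ≤
        2 * (Real.exp (θ * (c + 1)) * (2 * Q)) ^ 2 / Δ₀ ^ 2 :=
      div_le_div_of_nonneg_right (by linarith) (by positivity)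
    have h4 := mul_le_mul_of_nonneg_right (mul_le_mul_of_nonneg_left h3
      (by positivity : (0 : ℝ) ≤ 2 * A₁)) hlog.le
    refine h4.trans_eq ?_
    rw [hX_def]
    ring
  -- the zero has multiplicity `≥ 1`
  have hne1 : (1 / 2 + η + γ₀ * I : ℂ) ≠ 1 := by
    intro h
    apply hγ
    have := congrArg Complex.im h
    simpa using this
  have hm1 : (1 : ℝ) ≤ (riemannZetaZeroOrder (1 / 2 + η + γ₀ * I) : ℝ) := by
    have := (riemannZetaZeroOrder_pos_iff hne1).mpr hζ
    have h1m : (1 : ℤ) ≤ riemannZetaZeroOrder (1 / 2 + η + γ₀ * I) := by omega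
    exact_mod_cast h1m
  have hmP := mul_le_mul_of_nonneg_right hm1 (sq_nonneg ‖∫ t, k t * cexp ((η : ℂ) * t)‖)
  have h2 : 2 * A₁ * (4 * (Q ^ 2 + Q ^ 2 + 2 * Q ^ 2)) * Real.log (|γ₀| + 2)
      + 2 * A₁ * (2 * (Real.exp (θ * (c + 1)) * ∫ t, ‖iteratedDeriv 2 k t‖) ^ 2
          / Δ₀ ^ (2 * 2 - 2)) * Real.log (|γ₀| + 2) <
      2 * ((riemannZetaZeroOrder (1 / 2 + η + γ₀ * I) : ℝ)
        * ‖∫ t, k t * cexp ((η : ℂ) * t)‖ ^ 2) := by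
    linarith [hwin, hG, hmP, hlog, hBf, hXL, hAXL]
  have key := hT k (c + 1) η γ₀ R _ 1 S' Sf hk hkodd (by linarith) hR hks hpos hζ
    (abs_lt.mpr ⟨by linarith, hη2⟩) hη.ne' hγ hvan hSf1 hF1 hloc4
  exact key (by linarith [h1, h2])


/-! ## T31: window, parameter-free and exclusion forms -/

/-- **T31 (far-offset cluster visibility, window form).**  As T29 with far offsets `≤ θ < ½` and
near zone `Δ₀ ≥ e^{θ(c+1)}`; the window offset `clusterFarC0 ψ N R₀ δ η` is unchanged. -/
theorem weilGroundEnergy_neg_of_farOffset_cluster_window_eff (hψ : ContDiff ℝ ∞ ψ)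
    (hsupp : tsupport ψ ⊆ Icc (-1) 1) (hψ0 : ∀ s, 0 ≤ ψ s) {η : ℝ} (hη : 0 < η)
    (hη2 : η < 1 / 2) (hΦ : 0 < bumpLaplace ψ η) (N : ℕ) (R₀ : ℝ) {δ : ℝ} (hδ : 0 < δ)
    (hδ1 : δ ≤ 1) {θ : ℝ} (hθ2 : θ < 1 / 2) :
    ∀ (γ₀ c R Δ₀ : ℝ) (S' : Finset ℂ), 1 ≤ |γ₀| →
      clusterFarC0 ψ N R₀ δ η + Real.log (Real.log (|γ₀| + 2)) / (2 * η) ≤ c → 1 ≤ R →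
      Real.exp (c + 1) ≤ R ^ 2 → Real.exp (θ * (c + 1)) ≤ Δ₀ → 1 ≤ Δ₀ →
      riemannZeta (1 / 2 + η + γ₀ * I) = 0 → S'.card ≤ N →
      (∀ ρ ∈ S', ‖ρ - (1 / 2 + γ₀ * I)‖ ≤ R₀ ∧ δ ≤ ‖ρ - (1 / 2 + η + γ₀ * I)‖ ∧
          δ ≤ ‖ρ - (1 / 2 - η + γ₀ * I)‖) →
      (∀ ρ : ℂ, riemannZeta ρ = 0 → 0 ≤ ρ.re → ρ.re ≤ 1 → |ρ.im - γ₀| < R → ρ.re ≠ 1 / 2 →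
          ρ = 1 / 2 + η + γ₀ * I ∨ ρ = 1 / 2 - η + γ₀ * I ∨ ρ ∈ S' ∨
            (|ρ.re - 1 / 2| ≤ θ ∧ Δ₀ ≤ |ρ.im - γ₀|)) →
      weilGroundEnergy (c + 1) < 0 := by
  intro γ₀ c R Δ₀ S' hγ hc hR hRa hΔ hΔ1 hζ hcard hclus hloc
  unfold clusterFarC0 at hc
  have hδN : 0 < δ ^ (4 * N) := by positivity
  have hK := clusterK_pos ψ N R₀
  have hKδ : 0 < 2 * clusterK ψ N R₀ / δ ^ (4 * N) := by positivity
  obtain ⟨hc0, hdom, hwin⟩ :=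
    doubleLog_window_arith hKδ hΦ (bumpLaplace_nonneg hψ0 (-η)) hη hγ hc
  have hγ0 : γ₀ ≠ 0 := by intro h; rw [h, abs_zero] at hγ; linarith
  have hΔ0 : 0 < Δ₀ := by linarith
  have hX : Real.exp (θ * (c + 1)) ^ 2 / Δ₀ ^ 2 ≤ 1 := by
    rw [div_le_one (by positivity)]
    exact pow_le_pow_left₀ (Real.exp_pos _).le hΔ 2
  have hlog : 0 < Real.log (|γ₀| + 2) := Real.log_pos (by linarith [abs_nonneg γ₀])
  have hwin' : clusterK ψ N R₀ * (1 + Real.exp (θ * (c + 1)) ^ 2 / Δ₀ ^ 2)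
      * Real.log (|γ₀| + 2) <
      η ^ 4 * δ ^ (4 * N) *
        (Real.exp (η * c) * bumpLaplace ψ η - bumpLaplace ψ (-η)) ^ 2 := by
    have h := mul_lt_mul_of_pos_left hwin hδN
    have hδne : δ ^ (4 * N) ≠ 0 := hδN.ne'
    have e : δ ^ (4 * N) * (2 * clusterK ψ N R₀ / δ ^ (4 * N) * Real.log (|γ₀| + 2)) =
        2 * clusterK ψ N R₀ * Real.log (|γ₀| + 2) := by
      field_simp
    rw [e] at h
    have hKL : 0 ≤ clusterK ψ N R₀ * Real.log (|γ₀| + 2) := by positivity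
    calc clusterK ψ N R₀ * (1 + Real.exp (θ * (c + 1)) ^ 2 / Δ₀ ^ 2) * Real.log (|γ₀| + 2)
        = (1 + Real.exp (θ * (c + 1)) ^ 2 / Δ₀ ^ 2)
            * (clusterK ψ N R₀ * Real.log (|γ₀| + 2)) := by ring
      _ ≤ 2 * (clusterK ψ N R₀ * Real.log (|γ₀| + 2)) :=
          mul_le_mul_of_nonneg_right (by linarith) hKL
      _ = 2 * clusterK ψ N R₀ * Real.log (|γ₀| + 2) := by ring
      _ < δ ^ (4 * N) * (η ^ 4 *
            (Real.exp (η * c) * bumpLaplace ψ η - bumpLaplace ψ (-η)) ^ 2) := h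
      _ = η ^ 4 * δ ^ (4 * N) *
            (Real.exp (η * c) * bumpLaplace ψ η - bumpLaplace ψ (-η)) ^ 2 := by ring
  exact weilGroundEnergy_neg_of_farOffset_cluster_eff hψ hsupp hψ0 N R₀ η θ γ₀ c R δ Δ₀ S' hη hη2
    hθ2 hγ0 hc0 hR hRa hδ hδ1 hΔ1 hζ hcard hclus hloc hdom hwin'

/-! ## T31′: the parameter-free form (`ψ₁ = windowPlateau 1`, either sign of `η`) -/

/-- **T31′ (far-offset cluster visibility, parameter-free).**  With `ψ₁ = windowPlateau 1` and
the definite offset `clusterFarC0 ψ₁ N R₀ δ |η|`, for either sign of `η ≠ 0`, `|η| < ½`, and any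
`θ < ½`: `|γ₀| ≥ 1`, `c ≥ c₀ + log log(|γ₀| + 2)/(2|η|)`, `R ≥ 1`, `e^{c+1} ≤ R²`,
`e^{θ(c+1)} ≤ Δ₀`, `Δ₀ ≥ 1`, `ζ(½ + η + iγ₀) = 0`, the near cluster hypothesis and "no offset
larger than `θ` at height distance `≥ Δ₀` in the window" ⟹ `ε(c + 1) < 0`. -/
theorem weilGroundEnergy_neg_of_farOffset_cluster_offset_eff {η : ℝ} (hη0 : η ≠ 0)
    (hη : |η| < 1 / 2) (N : ℕ) (R₀ : ℝ) {δ : ℝ} (hδ : 0 < δ) (hδ1 : δ ≤ 1) {θ : ℝ}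
    (hθ2 : θ < 1 / 2) :
    ∀ (γ₀ c R Δ₀ : ℝ) (S' : Finset ℂ), 1 ≤ |γ₀| →
      clusterFarC0 (windowPlateau 1) N R₀ δ |η| + Real.log (Real.log (|γ₀| + 2)) / (2 * |η|)
        ≤ c →
      1 ≤ R → Real.exp (c + 1) ≤ R ^ 2 → Real.exp (θ * (c + 1)) ≤ Δ₀ → 1 ≤ Δ₀ →
      riemannZeta (1 / 2 + η + γ₀ * I) = 0 → S'.card ≤ N →
      (∀ ρ ∈ S', ‖ρ - (1 / 2 + γ₀ * I)‖ ≤ R₀ ∧ δ ≤ ‖ρ - (1 / 2 + η + γ₀ * I)‖ ∧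
          δ ≤ ‖ρ - (1 / 2 - η + γ₀ * I)‖) →
      (∀ ρ : ℂ, riemannZeta ρ = 0 → 0 ≤ ρ.re → ρ.re ≤ 1 → |ρ.im - γ₀| < R → ρ.re ≠ 1 / 2 →
          ρ = 1 / 2 + η + γ₀ * I ∨ ρ = 1 / 2 - η + γ₀ * I ∨ ρ ∈ S' ∨
            (|ρ.re - 1 / 2| ≤ θ ∧ Δ₀ ≤ |ρ.im - γ₀|)) →
      weilGroundEnergy (c + 1) < 0 := by
  have hpos : 0 < |η| := abs_pos.mpr hη0
  have hT := weilGroundEnergy_neg_of_farOffset_cluster_window_eff (ψ := windowPlateau 1)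
    (contDiff_windowPlateau 1) (tsupport_windowPlateau_subset 1) (windowPlateau_nonneg 1) hpos hη
    (bumpLaplace_windowPlateau_one_pos |η|) N R₀ hδ hδ1 hθ2
  intro γ₀ c R Δ₀ S' hγ hc hR hRa hΔ hΔ1 hζ hcard hclus hloc
  rcases le_or_gt 0 η with h | h
  · have e : |η| = η := abs_of_nonneg h
    rw [e] at hT hc
    exact hT γ₀ c R Δ₀ S' hγ hc hR hRa hΔ hΔ1 hζ hcard hclus hloc
  · have e : |η| = -η := abs_of_neg h
    rw [e] at hT hc
    refine hT γ₀ c R Δ₀ S' hγ hc hR hRa hΔ hΔ1 ?_ hcard ?_ ?_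
    · push_cast
      rw [show (1 / 2 + -(η : ℂ) + γ₀ * I) = 1 / 2 - η + γ₀ * I by ring]
      exact riemannZeta_zero_reflect hη hζ
    · intro ρ hρ
      obtain ⟨h1, h2, h3⟩ := hclus ρ hρ
      push_cast
      refine ⟨h1, ?_, ?_⟩
      · rw [show (1 / 2 + -(η : ℂ) + γ₀ * I) = 1 / 2 - η + γ₀ * I by ring]; exact h3
      · rw [show (1 / 2 - -(η : ℂ) + γ₀ * I) = 1 / 2 + η + γ₀ * I by ring]; exact h2
    · intro ρ hz h0 h1 hnear hre
      push_cast
      rw [show (1 / 2 + -(η : ℂ) + γ₀ * I) = 1 / 2 - η + γ₀ * I by ring,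
        show (1 / 2 - -(η : ℂ) + γ₀ * I) = 1 / 2 + η + γ₀ * I by ring]
      rcases hloc ρ hz h0 h1 hnear hre with h' | h' | h' | h'
      · exact Or.inr (Or.inl h')
      · exact Or.inl h'
      · exact Or.inr (Or.inr (Or.inl h'))
      · exact Or.inr (Or.inr (Or.inr h'))

/-- **T31″ (exclusion form).**  Weil positivity at the window `c + 1`, the near cluster
hypothesis in the zone `|Im ρ − γ₀| < Δ₀` (`Δ₀ ≥ max(1, e^{θ(c+1)})`) and the bound `θ < ½` on the
offsets of the window zeros at height distance `≥ Δ₀` EXCLUDE the zero `½ + η + iγ₀`. -/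
theorem riemannZeta_ne_zero_of_farOffset_cluster_of_weilGroundEnergy_nonneg_eff {η : ℝ}
    (hη0 : η ≠ 0) (hη : |η| < 1 / 2) (N : ℕ) (R₀ : ℝ) {δ : ℝ} (hδ : 0 < δ) (hδ1 : δ ≤ 1) {θ : ℝ}
    (hθ2 : θ < 1 / 2) :
    ∀ (γ₀ c R Δ₀ : ℝ) (S' : Finset ℂ), 1 ≤ |γ₀| →
      clusterFarC0 (windowPlateau 1) N R₀ δ |η| + Real.log (Real.log (|γ₀| + 2)) / (2 * |η|)
        ≤ c →
      1 ≤ R → Real.exp (c + 1) ≤ R ^ 2 → Real.exp (θ * (c + 1)) ≤ Δ₀ → 1 ≤ Δ₀ → S'.card ≤ N →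
      (∀ ρ ∈ S', ‖ρ - (1 / 2 + γ₀ * I)‖ ≤ R₀ ∧ δ ≤ ‖ρ - (1 / 2 + η + γ₀ * I)‖ ∧
          δ ≤ ‖ρ - (1 / 2 - η + γ₀ * I)‖) →
      (∀ ρ : ℂ, riemannZeta ρ = 0 → 0 ≤ ρ.re → ρ.re ≤ 1 → |ρ.im - γ₀| < R → ρ.re ≠ 1 / 2 →
          ρ = 1 / 2 + η + γ₀ * I ∨ ρ = 1 / 2 - η + γ₀ * I ∨ ρ ∈ S' ∨
            (|ρ.re - 1 / 2| ≤ θ ∧ Δ₀ ≤ |ρ.im - γ₀|)) →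
      0 ≤ weilGroundEnergy (c + 1) →
      riemannZeta (1 / 2 + η + γ₀ * I) ≠ 0 := by
  intro γ₀ c R Δ₀ S' hγ hc hR hRa hΔ hΔ1 hcard hclus hloc hE hζ
  have := weilGroundEnergy_neg_of_farOffset_cluster_offset_eff hη0 hη N R₀ hδ hδ1 hθ2 γ₀ c R Δ₀
    S' hγ hc hR hRa hΔ hΔ1 hζ hcard hclus hloc
  linarith

/-! ## T32: no hypothesis on the far offsets

The window `|Im ρ − γ₀| < R` holds finitely many zeros of `ζ` with `0 ≤ Re ρ ≤ 1`, all of them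
with `0 < Re ρ < 1`; so their largest offset `Θ = windowMaxOffset γ₀ R` is `< ½`, and T31″ with
`θ = Θ` needs NO hypothesis on the zeros at height distance `≥ Δ₀`, where
`Δ₀ ≥ max(1, e^{Θ(c+1)})` may be taken `≤ R^{2Θ} < R` (as `e^{c+1} ≤ R²`).  Thus Weil positivity at
the double-log window never needs the whole polylog window clean of further off-line zeros — only
its `R^{2Θ}` core, up to a bounded separated cluster. -/

/-- The largest offset `|Re ρ − ½|` among the zeros of `ζ` with `0 ≤ Re ρ ≤ 1` and
`|Im ρ − γ₀| < R` (`0` if there are none). -/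
noncomputable def windowMaxOffset (γ₀ R : ℝ) : ℝ :=
  sSup ((fun ρ : ℂ ↦ |ρ.re - 1 / 2|) ''
    {ρ : ℂ | riemannZeta ρ = 0 ∧ 0 ≤ ρ.re ∧ ρ.re ≤ 1 ∧ |ρ.im - γ₀| < R} ∪ {0})

/-- A zero of `ζ` with `Re ρ ≥ 0` has `Re ρ > 0` (the zeros in `Re s ≤ 0` are `−2, −4, …`). -/
theorem re_pos_of_riemannZeta_eq_zero_of_re_nonneg {ρ : ℂ} (hz : riemannZeta ρ = 0)
    (h0 : 0 ≤ ρ.re) : 0 < ρ.re := by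
  by_contra h
  obtain ⟨n, hn⟩ := (riemannZeta_eq_zero_iff_of_re_nonpos (not_lt.mp h)).mp hz
  have hre := congrArg Complex.re hn
  simp at hre
  have hn0 : (0 : ℝ) ≤ n := n.cast_nonneg
  linarith

/-- The zeros of `ζ` with `0 ≤ Re ρ ≤ 1` in a height window form a finite set. -/
theorem windowZeros_finite (γ₀ R : ℝ) :
    {ρ : ℂ | riemannZeta ρ = 0 ∧ 0 ≤ ρ.re ∧ ρ.re ≤ 1 ∧ |ρ.im - γ₀| < R}.Finite := by
  refine (weilZeroIndex_finite (|γ₀| + R)).subset fun ρ hρ ↦ ?_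
  have h0 := re_pos_of_riemannZeta_eq_zero_of_re_nonneg hρ.1 hρ.2.1
  have h1 := re_lt_one_of_riemannZeta_eq_zero hρ.1
  refine ⟨hρ.1, hρ.2.1, hρ.2.2.1, im_ne_zero_of_riemannZeta_eq_zero hρ.1 h0 h1, ?_⟩
  have h2 := abs_sub_abs_le_abs_sub ρ.im γ₀
  have h3 := hρ.2.2.2
  linarith

/-- `0 ≤ windowMaxOffset γ₀ R < ½`, and it bounds the offset of every zero of the window. -/
theorem windowMaxOffset_spec (γ₀ R : ℝ) :
    0 ≤ windowMaxOffset γ₀ R ∧ windowMaxOffset γ₀ R < 1 / 2 ∧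
      ∀ ρ : ℂ, riemannZeta ρ = 0 → 0 ≤ ρ.re → ρ.re ≤ 1 → |ρ.im - γ₀| < R →
        |ρ.re - 1 / 2| ≤ windowMaxOffset γ₀ R := by
  classical
  set Z : Set ℂ := {ρ : ℂ | riemannZeta ρ = 0 ∧ 0 ≤ ρ.re ∧ ρ.re ≤ 1 ∧ |ρ.im - γ₀| < R}
    with hZ
  set V : Set ℝ := (fun ρ : ℂ ↦ |ρ.re - 1 / 2|) '' Z ∪ {0} with hV
  have hVfin : V.Finite := ((windowZeros_finite γ₀ R).image _).union (Set.finite_singleton 0)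
  have hVne : V.Nonempty := ⟨0, Or.inr rfl⟩
  have hdef : windowMaxOffset γ₀ R = sSup V := rfl
  refine ⟨?_, ?_, fun ρ hz h0 h1 hR ↦ ?_⟩
  · rw [hdef]; exact le_csSup hVfin.bddAbove (Or.inr rfl)
  · have hmem := hVne.csSup_mem hVfin
    rw [← hdef] at hmem
    rcases hmem with ⟨ρ, hρ, he⟩ | h
    · rw [← he]
      have h0 := re_pos_of_riemannZeta_eq_zero_of_re_nonneg hρ.1 hρ.2.1
      have h1 := re_lt_one_of_riemannZeta_eq_zero hρ.1
      exact abs_lt.mpr ⟨by linarith, by linarith⟩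
    · rw [Set.mem_singleton_iff] at h
      rw [h]; norm_num
  · rw [hdef]
    exact le_csSup hVfin.bddAbove (Or.inl ⟨ρ, ⟨hz, h0, h1, hR⟩, rfl⟩)

/-- The near zone of T32 fits strictly inside the window: `e^{Θ(c+1)} ≤ R^{2Θ} < R`. -/
theorem exp_windowMaxOffset_mul_lt (γ₀ : ℝ) {c R : ℝ} (hR : 1 < R)
    (hRa : Real.exp (c + 1) ≤ R ^ 2) : Real.exp (windowMaxOffset γ₀ R * (c + 1)) < R := by
  obtain ⟨hθ0, hθ2, -⟩ := windowMaxOffset_spec γ₀ R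
  have hR0 : 0 < R := by linarith
  have hlogR : 0 < Real.log R := Real.log_pos hR
  have hc1 : c + 1 ≤ 2 * Real.log R := by
    have := Real.log_le_log (Real.exp_pos _) hRa
    rwa [Real.log_exp, Real.log_pow, Nat.cast_ofNat] at this
  calc Real.exp (windowMaxOffset γ₀ R * (c + 1))
      ≤ Real.exp (windowMaxOffset γ₀ R * (2 * Real.log R)) :=
        Real.exp_le_exp.mpr (mul_le_mul_of_nonneg_left hc1 hθ0)
    _ < Real.exp (Real.log R) := Real.exp_lt_exp.mpr (by nlinarith)
    _ = R := Real.exp_log hR0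

/-- **T32 (near-cluster visibility, no far hypothesis; exclusion form).**  With
`Θ = windowMaxOffset γ₀ R`: Weil positivity at the window `c + 1`
(`c ≥ clusterFarC0 ψ₁ N R₀ δ |η| + log log(|γ₀| + 2)/(2|η|)`, `e^{c+1} ≤ R²`) together with the
NEAR hypothesis only — every off-line zero with `|Im ρ − γ₀| < Δ₀` (`Δ₀ ≥ max(1, e^{Θ(c+1)})`,
which may be chosen `≤ R^{2Θ} < R`) is one of `½ ± η + iγ₀` or a member of the bounded separated
cluster `S'` — excludes the zero `½ + η + iγ₀`.  Nothing is assumed about the zeros at height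
distance `≥ Δ₀`. -/
theorem riemannZeta_ne_zero_of_nearCluster_of_weilGroundEnergy_nonneg_eff {η : ℝ}
    (hη0 : η ≠ 0) (hη : |η| < 1 / 2) (N : ℕ) (R₀ : ℝ) {δ : ℝ} (hδ : 0 < δ) (hδ1 : δ ≤ 1) :
    ∀ (γ₀ c R Δ₀ : ℝ) (S' : Finset ℂ), 1 ≤ |γ₀| →
      clusterFarC0 (windowPlateau 1) N R₀ δ |η| + Real.log (Real.log (|γ₀| + 2)) / (2 * |η|)
        ≤ c →
      1 ≤ R → Real.exp (c + 1) ≤ R ^ 2 → Real.exp (windowMaxOffset γ₀ R * (c + 1)) ≤ Δ₀ →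
      1 ≤ Δ₀ → S'.card ≤ N →
      (∀ ρ ∈ S', ‖ρ - (1 / 2 + γ₀ * I)‖ ≤ R₀ ∧ δ ≤ ‖ρ - (1 / 2 + η + γ₀ * I)‖ ∧
          δ ≤ ‖ρ - (1 / 2 - η + γ₀ * I)‖) →
      (∀ ρ : ℂ, riemannZeta ρ = 0 → 0 ≤ ρ.re → ρ.re ≤ 1 → |ρ.im - γ₀| < Δ₀ → ρ.re ≠ 1 / 2 →
          ρ = 1 / 2 + η + γ₀ * I ∨ ρ = 1 / 2 - η + γ₀ * I ∨ ρ ∈ S') →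
      0 ≤ weilGroundEnergy (c + 1) →
      riemannZeta (1 / 2 + η + γ₀ * I) ≠ 0 := by
  intro γ₀ c R Δ₀ S' hγ hc hR hRa hΔ hΔ1 hcard hclus hnear hE
  obtain ⟨-, hθ2, hoff⟩ := windowMaxOffset_spec γ₀ R
  refine riemannZeta_ne_zero_of_farOffset_cluster_of_weilGroundEnergy_nonneg_eff hη0 hη N R₀ hδ
    hδ1 hθ2 γ₀ c R Δ₀ S' hγ hc hR hRa hΔ hΔ1 hcard hclus ?_ hE
  intro ρ hz h0 h1 hRρ hre
  by_cases hn : |ρ.im - γ₀| < Δ₀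
  · rcases hnear ρ hz h0 h1 hn hre with h | h | h
    · exact Or.inl h
    · exact Or.inr (Or.inl h)
    · exact Or.inr (Or.inr (Or.inl h))
  · exact Or.inr (Or.inr (Or.inr ⟨hoff ρ hz h0 h1 hRρ, not_lt.mp hn⟩))

end Summit.RiemannHypothesis.RiemannHypothesis.Theorems
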